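import Literature.RepresentationTheory.Kovacevic2021.SU21CohomologyDegreeTwo
import Literature.RepresentationTheory.BorelWallach2000.SUn1CohomologicalModules
import HarnessLib

/-!
# Kovačević's `SU(2,1)`-modules: `C^q(𝔤, 𝔨; V) = 0` for every `q ≥ 5` and the complete table
# `q ↦ dim H^q(𝔤, 𝔨; V)` of the six cohomological modules — Borel–Wallach VI 4.11 at `n = 2`, all degrees

Topic `RepresentationTheory/Kovacevic2021`; namespace `Literature.RepresentationTheory.Kovacevic2021`.
Theorems only; no named fact.  Sequel to `SU21CohomologyDegreeTwo` (degrees `0 ≤ q ≤ 5`).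

For a `K`-type datum `𝒟 : SU21Datum` [Kovacevic2021, §3] and its `𝔤𝔩₃`-module `V = 𝒟.V`, the relative
Chevalley–Eilenberg cochains `C^q(𝔤, 𝔨; V) = relCochain 𝒟 q` (`𝔤 = 𝔤𝔩₃ ⊃ 𝔨 = kSub`, `𝔭 = ⟨E₀₂, E₁₂, E₂₀, E₂₁⟩`,
`Literature.Algebra.Lie.ChevalleyEilenberg.Subcomplex.rel`) satisfy:

* **`C^q(𝔤, 𝔨; V) = 0` for all `q ≥ 5` and EVERY datum** (`relCochain_eq_bot_of_five_le`): a relative cochain only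
  sees the `𝔭`-components of its arguments (`apply_eq_apply_pPart`: split `v_i = k_i + p_i`, expand multilinearly
  (`AlternatingMap.map_add_univ`), every term with a `𝔨`-entry dies by horizontality), and `q ≥ 5` vectors of the
  `4`-dimensional `𝔭 ≅ ℂ⁴` are linearly dependent (`AlternatingMap.map_linearDependent`) — Borel–Wallach's
  `C^q(𝔤,𝔨;V) = Hom_𝔨(Λ^q(𝔤/𝔨), V)` with `Λ^q ℂ⁴ = 0` for `q ≥ 5` [BorelWallach2000, I §1.2 (1)].  This supersedes the
  degree-`5` slot computation of `SU21RelativeCochainsDegreeFive` and gives **`H^q(𝔤, 𝔨; V) = 0` for `q ≥ 5`**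
  (`finrank_relCohomology_eq_zero_of_five_le`).
* **The complete table** for the six constructed modules of `SU21ModulesFromKTypes` (`trivialMod = U(0) = J_{0,0}`,
  `ladderPlus = Z(3) = J_{1,0}`, `ladderMinus = Z(-3) = J_{0,1}`, `holDS = D₂`, `midDS = D₁`, `antiholDS = D₀`), as
  closed forms in `q ∈ ℕ` assembled from `SU21CohomologyDegreeOne` (`q = 0, 1`), `SU21CohomologyDegreeTwo`
  (`2 ≤ q ≤ 5`) and the vanishing above:
  `dim H^q(U(0)) = [q ∈ {0,2,4}]` (`finrank_relCohomology_trivialMod`), `dim H^q(Z(±3)) = [q ∈ {1,3}]`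
  (`finrank_relCohomology_ladderPlus/Minus`), `dim H^q(D_i) = [q = 2]` (`finrank_relCohomology_holDS/antiholDS/midDS`);
  and the same in the shape of the tree's transcription of [BorelWallach2000, VI Thm 4.11 (2), (3)]
  (`Literature.RepresentationTheory.BorelWallach2000.SUn1Table.VI_4_11`, clauses (2)/(3), `n = 2`):
  `dim H^q(J_{ij}) = [JDegree 2 i j q]` for `(i,j) = (0,0), (1,0), (0,1)` (`finrank_relCohomology_J00/J10/J01_eq_jDegree`,
  with `SUn1Table.JDegree n i j q ↔ ∃ l ≤ n - i - j, q = i + j + 2l`) and `dim H^q(D_i) = [q = n]` (`finrank_relCohomology_D`).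

NOT here: an instance of the dictionary `SUn1Table 2` — its clause (1) ("every cohomological irreducible
`(𝔤,K)`-module is a `J_{ij}` or a `D_i`") is the classification at infinitesimal character `ρ`, which the tree does
not have for actual modules (audit B11-1′ of the COR-CM cell: a table over a hand-picked `Mod` discharges nothing);
the `(𝔤, K)`-complex of the real group (here `K = S(U(2)×U(1))` is connected and `C^q(𝔤,K;V) = C^q(𝔤,𝔨;V)`).

## References

* A. Borel, N. Wallach (2000), I §1.2 (1) p. 8; VI 4.8 (5), Thm 4.11 (2), (3), pp. 131–133 (held chunks p0059,
  p0166, p0168–p0169). [BorelWallach2000]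
* D. Kovačević, Acta Math. Spalatensia 1 (2021) 105–125, §3 Def 1, §4 Thm 5. [Kovacevic2021]
* D. A. Vogan, G. J. Zuckerman, Compositio Math. 53 (1984) 51–90 (rank-one case). [VoganZuckerman1984]
-/

noncomputable section

open Finsupp Module
open Literature.Algebra.Lie Literature.Algebra.Lie.ChevalleyEilenberg
open Literature.RepresentationTheory.BorelWallach2000

namespace Literature.RepresentationTheory.Kovacevic2021

-- Mathlib idiom (Mathlib/Algebra/Lie/OfAssociative.lean): bracket on `Matrix`/`Module.End` = commutator.
attribute [local instance 100] LieRing.ofAssociativeRing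

namespace SU21Datum

variable (𝒟 : SU21Datum)

/-! ### `C^q(𝔤, 𝔨; V) = 0` for `q ≥ 5` (any datum): a relative cochain factors through `Λ^q 𝔭`, `dim 𝔭 = 4` -/

section Vanishing

variable {𝒟}

/-- `y = kPart y + (y₀₂ E₀₂ + y₁₂ E₁₂ + y₂₀ E₂₀ + y₂₁ E₂₁)`: the `𝔭`-part of `y` as the linear combination of the
basis `E₀₂, E₁₂, E₂₀, E₂₁` of `𝔭` with coefficient vector `(y₀₂, y₁₂, y₂₀, y₂₁) ∈ ℂ⁴`. [cite: BorelWallach2000, VI 4.7] -/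
theorem linearCombination_pCoords_add_kPart (y : gl3) :
    Fintype.linearCombination ℂ ![E 0 2, E 1 2, E 2 0, E 2 1] ![y 0 2, y 1 2, y 2 0, y 2 1] + kPart y = y := by
  rw [Fintype.linearCombination_apply, Fin.sum_univ_four]
  simp only [Matrix.cons_val_zero, Matrix.cons_val_one, Matrix.cons_val_two, Matrix.cons_val_three,
    Matrix.tail_cons, Matrix.head_cons]
  rw [← kPart_add y]
  simp only [kPart]
  abel

/-- **A relative cochain only sees the `𝔭`-parts of its arguments**: `f(v_0, …, v_q) = f(p_0, …, p_q)` with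
`p_i = v_i - kPart v_i ∈ 𝔭` (expand `v_i = p_i + k_i` multilinearly; every term with a `𝔨`-entry vanishes by
horizontality). [cite: BorelWallach2000, I §1.2 (1)] [cite: ChevalleyEilenberg1948, §28 (28.1)] -/
theorem apply_eq_apply_pPart {q : ℕ} {f : Cochain ℂ gl3 𝒟.V (q + 1)} (hf : f ∈ 𝒟.relCochain (q + 1))
    (v : Fin (q + 1) → gl3) :
    f v = f (fun i => Fintype.linearCombination ℂ ![E 0 2, E 1 2, E 2 0, E 2 1]
      ![(v i) 0 2, (v i) 1 2, (v i) 2 0, (v i) 2 1]) := by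
  classical
  set p : Fin (q + 1) → gl3 := fun i => Fintype.linearCombination ℂ ![E 0 2, E 1 2, E 2 0, E 2 1]
      ![(v i) 0 2, (v i) 1 2, (v i) 2 0, (v i) 2 1] with hp
  have hv : v = p + fun i => kPart (v i) := by
    funext i
    simp only [hp, Pi.add_apply, linearCombination_pCoords_add_kPart]
  rw [hv, AlternatingMap.map_add_univ, Finset.sum_eq_single Finset.univ]
  · rw [Finset.piecewise_univ]
  · intro s _ hs
    obtain ⟨i, hi⟩ : ∃ i, i ∉ s := by
      by_contra h
      push Not at h
      exact hs (Finset.eq_univ_iff_forall.2 h)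
    exact apply_eq_zero_of_slot_mem hf _ i (by rw [Finset.piecewise_eq_of_notMem (hi := hi)]; exact kPart_mem _)
  · exact fun h => absurd (Finset.mem_univ _) h

/-- `q + 1 ≥ 5` coefficient vectors in `ℂ⁴` are linearly dependent, hence so are the `𝔭`-parts [folklore] -/
private theorem not_linearIndependent_pPart {q : ℕ} (hq : 5 ≤ q + 1) (v : Fin (q + 1) → gl3) :
    ¬ LinearIndependent ℂ (fun i => Fintype.linearCombination ℂ ![E 0 2, E 1 2, E 2 0, E 2 1]
      ![(v i) 0 2, (v i) 1 2, (v i) 2 0, (v i) 2 1]) := by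
  intro h
  have h' : LinearIndependent ℂ (fun i : Fin (q + 1) => (![(v i) 0 2, (v i) 1 2, (v i) 2 0, (v i) 2 1] : Fin 4 → ℂ)) :=
    LinearIndependent.of_comp (Fintype.linearCombination ℂ ![E 0 2, E 1 2, E 2 0, E 2 1]) h
  have hcard := h'.fintype_card_le_finrank
  rw [Fintype.card_fin, Module.finrank_fin_fun] at hcard
  omega

/-- **`C^q(𝔤, 𝔨; V) = 0` for `q ≥ 5`**, for every `K`-type datum: `C^q(𝔤,𝔨;V) = Hom_𝔨(Λ^q 𝔭, V)` and `Λ^q 𝔭 = 0`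
(`dim 𝔭 = 4`). [cite: BorelWallach2000, I §1.2 (1), VI Thm 4.11] -/
theorem relCochain_eq_bot_of_five_le (𝒟 : SU21Datum) {q : ℕ} (hq : 5 ≤ q) : 𝒟.relCochain q = ⊥ := by
  obtain ⟨q, rfl⟩ : ∃ q', q = q' + 1 := ⟨q - 1, by omega⟩
  rw [Submodule.eq_bot_iff]
  intro f hf
  refine AlternatingMap.ext fun v => ?_
  rw [apply_eq_apply_pPart hf v, AlternatingMap.zero_apply]
  exact AlternatingMap.map_linearDependent f _ (not_linearIndependent_pPart hq v)

end Vanishing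

/-- **`H^q(𝔤, 𝔨; V) = 0` for `q ≥ 5`**, for every `K`-type datum (`C^q = 0`).
[cite: BorelWallach2000, I §1.2 (1), VI Thm 4.11 (2), (3)] -/
theorem finrank_relCohomology_eq_zero_of_five_le {q : ℕ} (hq : 5 ≤ q) :
    finrank ℂ (relCohomology ℂ gl3 𝒟.V kSub q) = 0 :=
  𝒟.finrank_relCohomology_eq_zero q (𝒟.relCochain_eq_bot_of_five_le hq)

/-! ### The complete table of the six cohomological modules (all degrees) -/

section Six

/-- **`dim H^q(𝔤, 𝔨; U(0)) = 1` for `q = 0, 2, 4` and `0` otherwise** (`J_{0,0}`: the cohomology of the compact dual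
`ℙ²(ℂ)`). [cite: BorelWallach2000, VI Thm 4.11 (3)] -/
theorem finrank_relCohomology_trivialMod (q : ℕ) :
    finrank ℂ (relCohomology ℂ gl3 trivialMod.V kSub q) = if q = 0 ∨ q = 2 ∨ q = 4 then 1 else 0 := by
  rcases Nat.lt_or_ge q 5 with hq | hq
  · interval_cases q
    · rw [if_pos (Or.inl rfl)]; exact finrank_relCohomology_zero_trivialMod
    · rw [if_neg (by omega)]; exact finrank_relCohomology_one_trivialMod
    · rw [if_pos (Or.inr (Or.inl rfl))]; exact finrank_relCohomology_two_trivialMod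
    · rw [if_neg (by omega)]; exact finrank_relCohomology_three_eq_zero_four.1
    · rw [if_pos (Or.inr (Or.inr rfl))]; exact finrank_relCohomology_four_trivialMod
  · rw [if_neg (by omega)]; exact trivialMod.finrank_relCohomology_eq_zero_of_five_le hq

/-- **`dim H^q(𝔤, 𝔨; D₂) = [q = 2]`** (holomorphic discrete series, Hodge type `(2,0)`).
[cite: BorelWallach2000, VI Thm 4.11 (2)] -/
theorem finrank_relCohomology_holDS (q : ℕ) :
    finrank ℂ (relCohomology ℂ gl3 holDS.V kSub q) = if q = 2 then 1 else 0 := by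
  rcases Nat.lt_or_ge q 5 with hq | hq
  · interval_cases q
    · rw [if_neg (by omega)]; exact finrank_relCohomology_zero_five.1
    · rw [if_neg (by omega)]; exact finrank_relCohomology_one_holDS
    · rw [if_pos rfl]; exact finrank_relCohomology_two_holDS
    · rw [if_neg (by omega)]; exact finrank_relCohomology_three_eq_zero_four.2.1
    · rw [if_neg (by omega)]; exact finrank_relCohomology_four_eq_zero_five.1
  · rw [if_neg (by omega)]; exact holDS.finrank_relCohomology_eq_zero_of_five_le hq

/-- **`dim H^q(𝔤, 𝔨; D₀) = [q = 2]`** (antiholomorphic discrete series, Hodge type `(0,2)`).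
[cite: BorelWallach2000, VI Thm 4.11 (2)] -/
theorem finrank_relCohomology_antiholDS (q : ℕ) :
    finrank ℂ (relCohomology ℂ gl3 antiholDS.V kSub q) = if q = 2 then 1 else 0 := by
  rcases Nat.lt_or_ge q 5 with hq | hq
  · interval_cases q
    · rw [if_neg (by omega)]; exact finrank_relCohomology_zero_five.2.1
    · rw [if_neg (by omega)]; exact finrank_relCohomology_one_antiholDS
    · rw [if_pos rfl]; exact finrank_relCohomology_two_antiholDS
    · rw [if_neg (by omega)]; exact finrank_relCohomology_three_eq_zero_four.2.2.1
    · rw [if_neg (by omega)]; exact finrank_relCohomology_four_eq_zero_five.2.1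
  · rw [if_neg (by omega)]; exact antiholDS.finrank_relCohomology_eq_zero_of_five_le hq

/-- **`dim H^q(𝔤, 𝔨; D₁) = [q = 2]`** (the discrete series of lowest `K`-type `F_{1,1}`, Hodge type `(1,1)`).
[cite: BorelWallach2000, VI Thm 4.11 (2)] -/
theorem finrank_relCohomology_midDS (q : ℕ) :
    finrank ℂ (relCohomology ℂ gl3 midDS.V kSub q) = if q = 2 then 1 else 0 := by
  rcases Nat.lt_or_ge q 5 with hq | hq
  · interval_cases q
    · rw [if_neg (by omega)]; exact finrank_relCohomology_zero_five.2.2.1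
    · rw [if_neg (by omega)]; exact finrank_relCohomology_one_midDS
    · rw [if_pos rfl]; exact finrank_relCohomology_two_midDS
    · rw [if_neg (by omega)]; exact finrank_relCohomology_three_eq_zero_four.2.2.2
    · rw [if_neg (by omega)]; exact finrank_relCohomology_four_eq_zero_five.2.2.1
  · rw [if_neg (by omega)]; exact midDS.finrank_relCohomology_eq_zero_of_five_le hq

/-- **`dim H^q(𝔤, 𝔨; Z(3)) = [q ∈ {1,3}]`** (`J_{1,0}`, Hodge types `(1,0)` and `(2,1)`).
[cite: BorelWallach2000, VI Thm 4.11 (3)] -/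
theorem finrank_relCohomology_ladderPlus (q : ℕ) :
    finrank ℂ (relCohomology ℂ gl3 ladderPlus.V kSub q) = if q = 1 ∨ q = 3 then 1 else 0 := by
  rcases Nat.lt_or_ge q 5 with hq | hq
  · interval_cases q
    · rw [if_neg (by omega)]; exact finrank_relCohomology_zero_five.2.2.2.1
    · rw [if_pos (Or.inl rfl)]; exact finrank_relCohomology_one_ladderPlus
    · rw [if_neg (by omega)]; exact finrank_relCohomology_two_ladderPlus
    · rw [if_pos (Or.inr rfl)]; exact finrank_relCohomology_three_ladderPlus
    · rw [if_neg (by omega)]; exact finrank_relCohomology_four_eq_zero_five.2.2.2.1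
  · rw [if_neg (by omega)]; exact ladderPlus.finrank_relCohomology_eq_zero_of_five_le hq

/-- **`dim H^q(𝔤, 𝔨; Z(-3)) = [q ∈ {1,3}]`** (`J_{0,1}`, Hodge types `(0,1)` and `(1,2)`).
[cite: BorelWallach2000, VI Thm 4.11 (3)] -/
theorem finrank_relCohomology_ladderMinus (q : ℕ) :
    finrank ℂ (relCohomology ℂ gl3 ladderMinus.V kSub q) = if q = 1 ∨ q = 3 then 1 else 0 := by
  rcases Nat.lt_or_ge q 5 with hq | hq
  · interval_cases q
    · rw [if_neg (by omega)]; exact finrank_relCohomology_zero_five.2.2.2.2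
    · rw [if_pos (Or.inl rfl)]; exact finrank_relCohomology_one_ladderMinus
    · rw [if_neg (by omega)]; exact finrank_relCohomology_two_ladderMinus
    · rw [if_pos (Or.inr rfl)]; exact finrank_relCohomology_three_ladderMinus
    · rw [if_neg (by omega)]; exact finrank_relCohomology_four_eq_zero_five.2.2.2.2
  · rw [if_neg (by omega)]; exact ladderMinus.finrank_relCohomology_eq_zero_of_five_le hq

/-! #### The same table in the shape of Borel–Wallach VI Theorem 4.11 (2), (3) (`n = 2`) -/

/-- **VI 4.11 (3) for `J_{0,0} = U(0)`**: `dim H^q(𝔤, 𝔨; J_{0,0}) = 1` iff `q = 0 + 0 + 2l`, `0 ≤ l ≤ 2`, else `0`.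
[cite: BorelWallach2000, VI Thm 4.11 (3) p. 132] -/
theorem finrank_relCohomology_J00_eq_jDegree (q : ℕ) :
    finrank ℂ (relCohomology ℂ gl3 trivialMod.V kSub q) = if SUn1Table.JDegree 2 0 0 q then 1 else 0 := by
  rw [finrank_relCohomology_trivialMod]
  have e : (q = 0 ∨ q = 2 ∨ q = 4) ↔ SUn1Table.JDegree 2 0 0 q := by
    rw [SUn1Table.jDegree_two_iff 0 0 q (by omega)]
    omega
  simp only [e]

/-- **VI 4.11 (3) for `J_{1,0} = Z(3)`**: `dim H^q(𝔤, 𝔨; J_{1,0}) = 1` iff `q = 1 + 0 + 2l`, `0 ≤ l ≤ 1`, else `0`.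
[cite: BorelWallach2000, VI Thm 4.11 (3) p. 132] -/
theorem finrank_relCohomology_J10_eq_jDegree (q : ℕ) :
    finrank ℂ (relCohomology ℂ gl3 ladderPlus.V kSub q) = if SUn1Table.JDegree 2 1 0 q then 1 else 0 := by
  rw [finrank_relCohomology_ladderPlus]
  have e : (q = 1 ∨ q = 3) ↔ SUn1Table.JDegree 2 1 0 q := by
    rw [SUn1Table.jDegree_two_iff 1 0 q (by omega)]
    omega
  simp only [e]

/-- **VI 4.11 (3) for `J_{0,1} = Z(-3)`**: `dim H^q(𝔤, 𝔨; J_{0,1}) = 1` iff `q = 0 + 1 + 2l`, `0 ≤ l ≤ 1`, else `0`.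
[cite: BorelWallach2000, VI Thm 4.11 (3) p. 132] -/
theorem finrank_relCohomology_J01_eq_jDegree (q : ℕ) :
    finrank ℂ (relCohomology ℂ gl3 ladderMinus.V kSub q) = if SUn1Table.JDegree 2 0 1 q then 1 else 0 := by
  rw [finrank_relCohomology_ladderMinus]
  have e : (q = 1 ∨ q = 3) ↔ SUn1Table.JDegree 2 0 1 q := by
    rw [SUn1Table.jDegree_two_iff 0 1 q (by omega)]
    omega
  simp only [e]

/-- **VI 4.11 (2) at `n = 2`**: for the three discrete series `D₀ = antiholDS`, `D₁ = midDS`, `D₂ = holDS`,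
`dim H^q(𝔤, 𝔨; D_i) = 1` if `q = n = 2` and `0` if `q ≠ 2`. [cite: BorelWallach2000, VI Thm 4.11 (2) p. 132] -/
theorem finrank_relCohomology_D (q : ℕ) :
    ((q = 2 → finrank ℂ (relCohomology ℂ gl3 antiholDS.V kSub q) = 1) ∧
      (q ≠ 2 → finrank ℂ (relCohomology ℂ gl3 antiholDS.V kSub q) = 0)) ∧
    ((q = 2 → finrank ℂ (relCohomology ℂ gl3 midDS.V kSub q) = 1) ∧
      (q ≠ 2 → finrank ℂ (relCohomology ℂ gl3 midDS.V kSub q) = 0)) ∧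
    ((q = 2 → finrank ℂ (relCohomology ℂ gl3 holDS.V kSub q) = 1) ∧
      (q ≠ 2 → finrank ℂ (relCohomology ℂ gl3 holDS.V kSub q) = 0)) := by
  refine ⟨⟨fun h => ?_, fun h => ?_⟩, ⟨fun h => ?_, fun h => ?_⟩, ⟨fun h => ?_, fun h => ?_⟩⟩
  · rw [finrank_relCohomology_antiholDS, if_pos h]
  · rw [finrank_relCohomology_antiholDS, if_neg h]
  · rw [finrank_relCohomology_midDS, if_pos h]
  · rw [finrank_relCohomology_midDS, if_neg h]
  · rw [finrank_relCohomology_holDS, if_pos h]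
  · rw [finrank_relCohomology_holDS, if_neg h]

/-- **The cohomological degrees of the six modules, all at once** (`H^q ≠ 0` iff: `U(0)` and `q ∈ {0,2,4}`;
`Z(±3)` and `q ∈ {1,3}`; `D_i` and `q = 2`) — the `n = 2` table of [BorelWallach2000, VI Thm 4.11 (2), (3)] for the
constructed modules (compare `SUn1Table.hdim_ne_zero_iff` for the transcribed dictionary).
[cite: BorelWallach2000, VI Thm 4.11 (2), (3) p. 132] -/
theorem finrank_relCohomology_ne_zero_iff (q : ℕ) :
    (finrank ℂ (relCohomology ℂ gl3 trivialMod.V kSub q) ≠ 0 ↔ q = 0 ∨ q = 2 ∨ q = 4) ∧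
    (finrank ℂ (relCohomology ℂ gl3 ladderPlus.V kSub q) ≠ 0 ↔ q = 1 ∨ q = 3) ∧
    (finrank ℂ (relCohomology ℂ gl3 ladderMinus.V kSub q) ≠ 0 ↔ q = 1 ∨ q = 3) ∧
    (finrank ℂ (relCohomology ℂ gl3 holDS.V kSub q) ≠ 0 ↔ q = 2) ∧
    (finrank ℂ (relCohomology ℂ gl3 antiholDS.V kSub q) ≠ 0 ↔ q = 2) ∧
    (finrank ℂ (relCohomology ℂ gl3 midDS.V kSub q) ≠ 0 ↔ q = 2) := by
  refine ⟨?_, ?_, ?_, ?_, ?_, ?_⟩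
  · rw [finrank_relCohomology_trivialMod]; split_ifs with h <;> simp [h]
  · rw [finrank_relCohomology_ladderPlus]; split_ifs with h <;> simp [h]
  · rw [finrank_relCohomology_ladderMinus]; split_ifs with h <;> simp [h]
  · rw [finrank_relCohomology_holDS]; split_ifs with h <;> simp [h]
  · rw [finrank_relCohomology_antiholDS]; split_ifs with h <;> simp [h]
  · rw [finrank_relCohomology_midDS]; split_ifs with h <;> simp [h]

/-- **Euler characteristics** `χ(𝔤, 𝔨; V) = Σ_q (-1)^q dim H^q`: `3` for `U(0)` (`= χ(ℙ²(ℂ))`), `-2` for `Z(±3)`, `1` for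
each `D_i` (sum over `q ≤ 4`; all higher terms vanish). [cite: BorelWallach2000, VI Thm 4.11 (2), (3)] -/
theorem eulerCharacteristic_six :
    (∑ q ∈ Finset.range 5, (-1 : ℤ) ^ q * (finrank ℂ (relCohomology ℂ gl3 trivialMod.V kSub q) : ℤ)) = 3 ∧
    (∑ q ∈ Finset.range 5, (-1 : ℤ) ^ q * (finrank ℂ (relCohomology ℂ gl3 ladderPlus.V kSub q) : ℤ)) = -2 ∧
    (∑ q ∈ Finset.range 5, (-1 : ℤ) ^ q * (finrank ℂ (relCohomology ℂ gl3 ladderMinus.V kSub q) : ℤ)) = -2 ∧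
    (∑ q ∈ Finset.range 5, (-1 : ℤ) ^ q * (finrank ℂ (relCohomology ℂ gl3 holDS.V kSub q) : ℤ)) = 1 ∧
    (∑ q ∈ Finset.range 5, (-1 : ℤ) ^ q * (finrank ℂ (relCohomology ℂ gl3 antiholDS.V kSub q) : ℤ)) = 1 ∧
    (∑ q ∈ Finset.range 5, (-1 : ℤ) ^ q * (finrank ℂ (relCohomology ℂ gl3 midDS.V kSub q) : ℤ)) = 1 := by
  simp only [Finset.sum_range_succ, Finset.sum_range_zero, finrank_relCohomology_trivialMod,
    finrank_relCohomology_ladderPlus, finrank_relCohomology_ladderMinus, finrank_relCohomology_holDS,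
    finrank_relCohomology_antiholDS, finrank_relCohomology_midDS]
  norm_num

end Six

end SU21Datum

end Literature.RepresentationTheory.Kovacevic2021
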